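/-
Copyright (c) 2026 the pub-hodgecm-mathlib formalisation cell (harness21).  Prover seat hodgecm-mathlib-LH4-p10 (g6): Track A «(D-RAM) FOUR-FRAME» squad of crux H413, (β) TABLE —
sub-dealer LH4-p05 (g8) β-BOARD v1 LEDGER #1 «(T3)(a) second arithmetic hand: the Finset re-indexing skeleton»; assembler F0P3a-p01 (g37) ((T1) v0 77d1a77d).  2026-09-04.
-/
import Summits.HodgeConjecture.HodgeConjecture.Theorems.F0P3cDyRamStableCountBoxReindex   -- ★ B10 PART 2 FILE 1 (LH4-p14): `vec3_eq_iff`, `sum_box_eq_triple_sum`, `triple_sum_eq_diag_add_planes`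
import HarnessLib

/-!
# Crux `H413`, line LH4 «(D-RAM) FOUR-FRAME» — (β) TABLE, (T3)(a): THE `Finset` RE-INDEXING SKELETON OF THE ODD LABELLED BOX SUM

Cell `hodgecm-mathlib` (D-0151), FLOOR 0, crux item H413 = `stmt-HodgeConjecture-24833`, route `HCCMUnconditional`; squad F0∕P3c∕LH4.  THEOREMS ONLY (pure `Finset` ∕ `ℚ`
bookkeeping; no lattice, no law); lane `--supports stmt-HodgeConjecture-24833 --as helper` (count-neutral).

WHAT.  The box sum `Σ_{a : Fin 3 → Fin (B+1)} v a` of F0P3a-p01 (g37)'s `OddLabelledBoxSum` ((T1) v0 77d1a77d; binder `_hzero` VERBATIM below) re-indexed onto the shape list of the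
odd table: the CORE `![0,0,0]`, the core-HANGING diagonal `![2ρ,2ρ,2ρ]` (`1 ≤ ρ ≤ B∕2`), the three TOWERS `![0,s,s] ∕ ![s,0,s] ∕ ![s,s,0]` (`1 ≤ s ≤ B`) and the three GLUED families
`![2ρ, 2ρ+s, 2ρ+s] ∕ ![2ρ+s, 2ρ, 2ρ+s] ∕ ![2ρ+s, 2ρ+s, 2ρ]` (`1 ≤ ρ ≤ B∕2`, `1 ≤ s ≤ B − 2ρ`):
`sum_box_eq_core_add_hanging_add_towers_add_glued`.  ALL `s ≥ 1` are kept (the odd-`s` points are zero by `hzero`, and the (T1) rows carry their own `2 ∣ s` guards, so (T3)(b) can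
rewrite the rows directly); only the repeated letter `r = 2ρ` is parity-filtered (odd `r` killed by `hzero`).
PROOF.  ★ B10 `sum_box_eq_triple_sum` + `triple_sum_eq_diag_add_planes` (its `hreg` follows from `hzero`: every shape is diagonal or a plane point with the repeated letter the
smaller one), the shift `t = r + s` on each plane, and the even∕odd split of the repeated letter (`sum_range_succ_eq_sum_even_add_sum_odd`).
HONEST LABEL.  Count-neutral bookkeeping; the identity `OddLabelledBoxSum` itself ((T3)(b)(c): per-family closed forms + exponent tiling) is F0P3a-p01 (g37)'s ∕ LH4-p08 (g9)'s; (β)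
OPEN; `HC_CM` is proved only modulo the 7 printed citations (2 remaining named inputs: hLiu418 = `stmt-HodgeConjecture-24832`, h413 = `stmt-HodgeConjecture-24833`) until rung 0 closes.

## References
* [Kottwitz1986BaseChangeUnits] R. E. Kottwitz, *Base change for unit elements of Hecke algebras*, Compositio Math. 60 (1986), §1 pp. 240–241 (orbit sums as lattice counts).
* [Rogawski1990] J. D. Rogawski, *Automorphic Representations of Unitary Groups in Three Variables*, Ann. of Math. Stud. 123 (1990), §4.9 Prop. 4.9.1 (a)(b) p. 55.
-/

set_option autoImplicit false

namespace Summit.HodgeConjecture.HodgeConjecture.Cruxes.H413.F0P3cDyRamOddLabelledBoxReindex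

open Finset
open Summit.HodgeConjecture.HodgeConjecture.Cruxes.H413.F0P3cDyRamStableCountBoxReindex (vec3_eq_iff sum_box_eq_triple_sum triple_sum_eq_diag_add_planes)

/-! ## §1  Two re-indexing lemmas: even∕odd split of a range, and the shift `t = r + s` -/

/-- `Σ_{r ≤ B} f r = Σ_{ρ ≤ B∕2} f (2ρ) + Σ_{ρ < (B+1)∕2} f (2ρ+1)`. [folklore] -/
theorem sum_range_succ_eq_sum_even_add_sum_odd (B : ℕ) (f : ℕ → ℚ) :
    ∑ r ∈ range (B + 1), f r = ∑ ρ ∈ range (B / 2 + 1), f (2 * ρ) + ∑ ρ ∈ range ((B + 1) / 2), f (2 * ρ + 1) := by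
  rw [← Finset.sum_filter_add_sum_filter_not (range (B + 1)) (fun r => r % 2 = 0) f]
  congr 1
  · refine Finset.sum_nbij' (fun r => r / 2) (fun ρ => 2 * ρ) ?_ ?_ ?_ ?_ ?_
    · intro r hr; simp only [Finset.mem_filter, Finset.mem_range] at hr ⊢; omega
    · intro ρ hρ; simp only [Finset.mem_filter, Finset.mem_range] at hρ ⊢; omega
    · intro r hr; simp only [Finset.mem_filter, Finset.mem_range] at hr; omega
    · intro ρ _; omega
    · intro r hr; simp only [Finset.mem_filter, Finset.mem_range] at hr; congr 1; omega
  · refine Finset.sum_nbij' (fun r => r / 2) (fun ρ => 2 * ρ + 1) ?_ ?_ ?_ ?_ ?_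
    · intro r hr; simp only [Finset.mem_filter, Finset.mem_range] at hr ⊢; omega
    · intro ρ hρ; simp only [Finset.mem_filter, Finset.mem_range] at hρ ⊢; omega
    · intro r hr; simp only [Finset.mem_filter, Finset.mem_range] at hr; omega
    · intro ρ _; omega
    · intro r hr; simp only [Finset.mem_filter, Finset.mem_range] at hr; congr 1; omega

/-- The shift `t = r + s` on a plane: `Σ_{t ≤ B} [r < t]·g t = Σ_{1 ≤ s ≤ B − r} g (r + s)` for `r ≤ B`. [folklore] -/
theorem sum_range_ite_lt_eq_sum_Icc_shift (B r : ℕ) (hr : r ≤ B) (g : ℕ → ℚ) :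
    ∑ t ∈ range (B + 1), (if r < t then g t else 0) = ∑ s ∈ Icc 1 (B - r), g (r + s) := by
  rw [← Finset.sum_filter]
  refine Finset.sum_nbij' (fun t => t - r) (fun s => r + s) ?_ ?_ ?_ ?_ ?_
  · intro t ht; simp only [Finset.mem_filter, Finset.mem_range, Finset.mem_Icc] at ht ⊢; omega
  · intro s hs; simp only [Finset.mem_filter, Finset.mem_range, Finset.mem_Icc] at hs ⊢; omega
  · intro t ht; simp only [Finset.mem_filter, Finset.mem_range] at ht; omega
  · intro s _; omega
  · intro t ht; simp only [Finset.mem_filter, Finset.mem_range] at ht; congr 1; omega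

/-! ## §2  The skeleton -/

/-- **(T3)(a) THE RE-INDEXING SKELETON OF THE ODD LABELLED BOX SUM**: for a table `v` vanishing off the shape list of F0P3a-p01's `OddLabelledBoxSum` (binder `_hzero` verbatim),
`Σ_{a ∈ [0,B]³} v a = v(core) + Σ_{1 ≤ ρ ≤ B∕2} v(2ρ,2ρ,2ρ) + Σ_{1 ≤ s ≤ B} (three towers at s) + Σ_{1 ≤ ρ ≤ B∕2} Σ_{1 ≤ s ≤ B−2ρ} (three glued strata at (ρ, s))`.
[cite: Kottwitz1986BaseChangeUnits, §1 pp. 240–241] -/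
theorem sum_box_eq_core_add_hanging_add_towers_add_glued (B : ℕ) (v : (Fin 3 → ℕ) → ℚ)
    (hzero : ∀ a : Fin 3 → ℕ, ¬ ((a = ![0, 0, 0]) ∨
      (∃ s, 2 ∣ s ∧ 2 ≤ s ∧ (a = ![0, s, s] ∨ a = ![s, 0, s] ∨ a = ![s, s, 0])) ∨
      (∃ ρ s, 1 ≤ ρ ∧ 2 ∣ s ∧ 2 ≤ s ∧ (a = ![2 * ρ, 2 * ρ + s, 2 * ρ + s] ∨ a = ![2 * ρ + s, 2 * ρ, 2 * ρ + s] ∨ a = ![2 * ρ + s, 2 * ρ + s, 2 * ρ])) ∨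
      (∃ ρ, 1 ≤ ρ ∧ a = ![2 * ρ, 2 * ρ, 2 * ρ])) → v a = 0) :
    ∑ a : Fin 3 → Fin (B + 1), v (fun j => (a j : ℕ)) =
      v ![0, 0, 0] + ∑ ρ ∈ Icc 1 (B / 2), v ![2 * ρ, 2 * ρ, 2 * ρ]
        + ∑ s ∈ Icc 1 B, (v ![0, s, s] + v ![s, 0, s] + v ![s, s, 0])
        + ∑ ρ ∈ Icc 1 (B / 2), ∑ s ∈ Icc 1 (B - 2 * ρ),
            (v ![2 * ρ, 2 * ρ + s, 2 * ρ + s] + v ![2 * ρ + s, 2 * ρ, 2 * ρ + s] + v ![2 * ρ + s, 2 * ρ + s, 2 * ρ]) := by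
  -- the vanishing of `v` off the shape list, in the three forms used below
  have hz : ∀ x y z : ℕ, (∀ s, 2 ∣ s → 2 ≤ s → ¬ (x = 0 ∧ y = s ∧ z = s) ∧ ¬ (x = s ∧ y = 0 ∧ z = s) ∧ ¬ (x = s ∧ y = s ∧ z = 0)) →
      (∀ ρ s, 1 ≤ ρ → 2 ∣ s → 2 ≤ s → ¬ (x = 2 * ρ ∧ y = 2 * ρ + s ∧ z = 2 * ρ + s) ∧ ¬ (x = 2 * ρ + s ∧ y = 2 * ρ ∧ z = 2 * ρ + s) ∧
        ¬ (x = 2 * ρ + s ∧ y = 2 * ρ + s ∧ z = 2 * ρ)) →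
      (∀ ρ, 1 ≤ ρ → ¬ (x = 2 * ρ ∧ y = 2 * ρ ∧ z = 2 * ρ)) → ¬ (x = 0 ∧ y = 0 ∧ z = 0) → v ![x, y, z] = 0 := by
    intro x y z hT hG hH hC
    refine hzero _ ?_
    rintro (h | ⟨s, hs2, hs, h | h | h⟩ | ⟨ρ, s, hρ, hs2, hs, h | h | h⟩ | ⟨ρ, hρ, h⟩) <;> rw [vec3_eq_iff] at h
    · exact hC h
    · exact (hT s hs2 hs).1 h
    · exact (hT s hs2 hs).2.1 h
    · exact (hT s hs2 hs).2.2 h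
    · exact (hG ρ s hρ hs2 hs).1 h
    · exact (hG ρ s hρ hs2 hs).2.1 h
    · exact (hG ρ s hρ hs2 hs).2.2 h
    · exact hH ρ hρ h
  -- the support is diagonal ∪ planes (the repeated letter the smaller one)
  have hreg : ∀ x y z : ℕ, v ![x, y, z] ≠ 0 → (x = y ∧ y = z) ∨ (y = z ∧ x < y) ∨ (x = z ∧ y < x) ∨ (x = y ∧ z < x) := by
    intro x y z hne
    by_contra hnot
    refine hne (hz x y z ?_ ?_ ?_ ?_)
    · intro s _ hs; refine ⟨?_, ?_, ?_⟩ <;> rintro ⟨rfl, rfl, rfl⟩ <;> omega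
    · intro ρ s hρ _ hs; refine ⟨?_, ?_, ?_⟩ <;> rintro ⟨rfl, rfl, rfl⟩ <;> omega
    · intro ρ _; rintro ⟨rfl, rfl, rfl⟩; omega
    · rintro ⟨rfl, rfl, rfl⟩; omega
  rw [sum_box_eq_triple_sum B v, triple_sum_eq_diag_add_planes B v hreg]
  -- odd repeated letter: zero on the diagonal and on every plane
  have hdiag_odd : ∀ ρ, v ![2 * ρ + 1, 2 * ρ + 1, 2 * ρ + 1] = 0 := by
    intro ρ
    refine hz _ _ _ ?_ ?_ ?_ ?_
    · intro s _ hs; refine ⟨?_, ?_, ?_⟩ <;> rintro ⟨h1, h2, h3⟩ <;> omega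
    · intro ρ' s hρ' hs2 hs; obtain ⟨s', rfl⟩ := hs2; refine ⟨?_, ?_, ?_⟩ <;> rintro ⟨h1, h2, h3⟩ <;> omega
    · intro ρ' _; rintro ⟨h1, -, -⟩; omega
    · rintro ⟨h1, -, -⟩; omega
  have hplane_odd : ∀ ρ s, v ![2 * ρ + 1, 2 * ρ + 1 + s, 2 * ρ + 1 + s] = 0 ∧ v ![2 * ρ + 1 + s, 2 * ρ + 1, 2 * ρ + 1 + s] = 0 ∧
      v ![2 * ρ + 1 + s, 2 * ρ + 1 + s, 2 * ρ + 1] = 0 := by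
    intro ρ s
    refine ⟨hz _ _ _ ?_ ?_ ?_ ?_, hz _ _ _ ?_ ?_ ?_ ?_, hz _ _ _ ?_ ?_ ?_ ?_⟩
    all_goals first
      | (intro s' _ hs'; refine ⟨?_, ?_, ?_⟩ <;> rintro ⟨h1, h2, h3⟩ <;> omega)
      | (intro ρ' s' hρ' hs2 hs'; obtain ⟨s'', rfl⟩ := hs2; refine ⟨?_, ?_, ?_⟩ <;> rintro ⟨h1, h2, h3⟩ <;> omega)
      | (intro ρ' _; rintro ⟨h1, h2, h3⟩; omega)
      | (rintro ⟨h1, h2, h3⟩; omega)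
  -- (1) the diagonal: core + hanging
  have hD : ∑ r ∈ range (B + 1), v ![r, r, r] = v ![0, 0, 0] + ∑ ρ ∈ Icc 1 (B / 2), v ![2 * ρ, 2 * ρ, 2 * ρ] := by
    rw [sum_range_succ_eq_sum_even_add_sum_odd B (fun r => v ![r, r, r])]
    simp only [hdiag_odd, Finset.sum_const_zero, add_zero]
    rw [Finset.range_eq_Ico, Finset.sum_eq_sum_Ico_succ_bot (by omega : 0 < B / 2 + 1), mul_zero]
    rfl
  -- (2) a plane, generically in the plane's value function
  have hP : ∀ w : ℕ → ℕ → ℚ, (∀ ρ s, w (2 * ρ + 1) s = 0) →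
      ∑ r ∈ range (B + 1), ∑ t ∈ range (B + 1), (if r < t then w r (t - r) else 0) =
        ∑ s ∈ Icc 1 B, w 0 s + ∑ ρ ∈ Icc 1 (B / 2), ∑ s ∈ Icc 1 (B - 2 * ρ), w (2 * ρ) s := by
    intro w hw
    have hshift : ∀ r ∈ range (B + 1), ∑ t ∈ range (B + 1), (if r < t then w r (t - r) else 0) = ∑ s ∈ Icc 1 (B - r), w r s := by
      intro r hr
      rw [sum_range_ite_lt_eq_sum_Icc_shift B r (by simp only [Finset.mem_range] at hr; omega) (fun t => w r (t - r))]
      refine Finset.sum_congr rfl fun s _ => ?_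
      rw [Nat.add_sub_cancel_left]
    rw [Finset.sum_congr rfl hshift, sum_range_succ_eq_sum_even_add_sum_odd B (fun r => ∑ s ∈ Icc 1 (B - r), w r s)]
    simp only [hw, Finset.sum_const_zero, add_zero]
    rw [Finset.range_eq_Ico, Finset.sum_eq_sum_Ico_succ_bot (by omega : 0 < B / 2 + 1), mul_zero, Nat.sub_zero]
    rfl
  have hP1 := hP (fun r s => v ![r, r + s, r + s]) (fun ρ s => (hplane_odd ρ s).1)
  have hP2 := hP (fun r s => v ![r + s, r, r + s]) (fun ρ s => (hplane_odd ρ s).2.1)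
  have hP3 := hP (fun r s => v ![r + s, r + s, r]) (fun ρ s => (hplane_odd ρ s).2.2)
  -- the planes' summands in the shifted form
  have hq1 : ∀ r ∈ range (B + 1), ∀ t ∈ range (B + 1), (if r < t then v ![r, t, t] else 0) = (if r < t then v ![r, r + (t - r), r + (t - r)] else 0) := by
    intro r _ t _; split_ifs with h
    · rw [Nat.add_sub_cancel' h.le]
    · rfl
  have hq2 : ∀ r ∈ range (B + 1), ∀ t ∈ range (B + 1), (if r < t then v ![t, r, t] else 0) = (if r < t then v ![r + (t - r), r, r + (t - r)] else 0) := by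
    intro r _ t _; split_ifs with h
    · rw [Nat.add_sub_cancel' h.le]
    · rfl
  have hq3 : ∀ r ∈ range (B + 1), ∀ t ∈ range (B + 1), (if r < t then v ![t, t, r] else 0) = (if r < t then v ![r + (t - r), r + (t - r), r] else 0) := by
    intro r _ t _; split_ifs with h
    · rw [Nat.add_sub_cancel' h.le]
    · rfl
  rw [Finset.sum_congr rfl fun r hr => Finset.sum_congr rfl fun t ht => hq1 r hr t ht,
    Finset.sum_congr rfl fun r hr => Finset.sum_congr rfl fun t ht => hq2 r hr t ht,
    Finset.sum_congr rfl fun r hr => Finset.sum_congr rfl fun t ht => hq3 r hr t ht, hP1, hP2, hP3, hD]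
  simp only [zero_add, Finset.sum_add_distrib]
  ring

end Summit.HodgeConjecture.HodgeConjecture.Cruxes.H413.F0P3cDyRamOddLabelledBoxReindex
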